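import Summits.ResolutionOfSingularities.ResolutionOfSingularities.Theorems.FrobeniusLadderFRationalResolutionTowerStep
import Literature.AlgebraicGeometry.Resolution.AffineBlowupUniversal
import Literature.AlgebraicGeometry.Resolution.BlowupsLocal
import Mathlib.Algebra.MonoidAlgebra.Basic
import Mathlib.RingTheory.FiniteType
import HarnessLib

/-!
# Toric surface programme: the blow-down `Bl_{(x,xy)} U(r,a) → U(r,a)` is an isomorphism over `D(w)`

Support file for crux stmt-ResolutionOfSingularities-15317 (`FrobeniusLadder.FRationalResolution`), line `redirect`,
lead c4 (toric surface programme for rung 4′: all affine toric surfaces `U(r,a) = Spec k[{m ∈ ℤ² : 0 ≤ m₂, a m₂ ≤ r m₁}]`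
over every field are resolved by the Hirzebruch–Jung tower of two-chart monomial blow-ups).

This file proves the worker stub `stub_toric_isIso_away_w`: for `1 ≤ a ≤ r` and the monomials
`x = χ^(1,0)`, `xy = χ^(1,1)`, `w = χ^(a,r)` of the toric surface algebra `TA[r,a] = k[σ∨ ∩ ℤ²]`, the
blow-down `π₀ : Bl_I U(r,a) → U(r,a)`, `I = (xy, x, x)`, restricts to an ISOMORPHISM over the basic
open `D(w)`. The argument is the general one (`isIso_affineBlowup_morphismRestrict_of_eq_basicOpen`, any
commutative ring): if `g ∈ I` is a nonzerodivisor and `I · w ⊆ (g)`, then over `D(w) = Spec R[1/w]`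
the centre becomes the principal ideal `(g)` generated by a nonzerodivisor (localization maps
preserve nonzerodivisors), so the pulled-back ideal sheaf `Ĩ|_{D(w)}` is an effective Cartier
divisor and the restricted blow-up `π₀ ∣_ D(w)` — a blow-up of it by `IsBlowup.restrict` applied to
`affineBlowup.isBlowup` — is an isomorphism (`IsBlowup.isIso`). For the toric surface:
`x · w = χ^(1+a, r) = v · xy` with `v = χ^(a, r-1) ∈ TA[r,a]` (as `(a, r-1) ∈ σ∨`: `0 ≤ r - 1` and
`a (r-1) ≤ r a`), so `I · w ⊆ (xy)`, and `xy ≠ 0` in the domain `TA[r,a] ⊆ k[ℤ²]`.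
-/

set_option linter.dupNamespace false

noncomputable section

namespace Summit.ResolutionOfSingularities.ResolutionOfSingularities.Theorems.FRationalResolution

open CategoryTheory AlgebraicGeometry TopologicalSpace
open Literature.AlgebraicGeometry.Resolution

universe u

/-- **The affine blowing up is an isomorphism over a basic open on which the centre becomes an
invertible ideal.** For an ideal `I` of a commutative ring `R`, an element `w ∈ R` and a
nonzerodivisor `g ∈ I` with `I · w ⊆ (g)`, the blow-down `Bl_I(Spec R) → Spec R` restricted over
`D(w)` is an isomorphism: `Γ(D(w), 𝒪) = R[1/w]` is a localization, in it `I · R[1/w] = (g)` with `g`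
still a nonzerodivisor, so the restricted ideal sheaf is an effective Cartier divisor and the
restricted blowing up (`IsBlowup.restrict` of `affineBlowup.isBlowup`) is an isomorphism
(`IsBlowup.isIso`). [folklore; GortzWedhorn2020 Prop. 13.91 and remark after Def. 13.90] -/
theorem isIso_affineBlowup_morphismRestrict_of_eq_basicOpen {R : Type u} [CommRing R]
    (I : Ideal R) {w g : R} (hg : g ∈ I) (hg0 : g ∈ nonZeroDivisors R)
    (hI : ∀ i ∈ I, i * w ∈ Ideal.span {g}) (U : (Spec (CommRingCat.of R)).Opens)
    (hU : U = PrimeSpectrum.basicOpen w) : IsIso (affineBlowup.π I ∣_ U) := by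
  refine ((affineBlowup.isBlowup I).restrict U).isIso ?_
  -- `U = D(w)` is affine
  have hUaff : IsAffineOpen U := by
    rw [hU]
    exact IsAffineOpen.Spec_basicOpen (R := CommRingCat.of R) w
  haveI : IsAffine (U : Scheme.{u}) := hUaff
  -- its ring of functions `Γ(U, ⊤) = Γ(Spec R, ι(U) '' ⊤)` is the localization `R[1/w]`
  have hV : U.ι ''ᵁ ⊤ = PrimeSpectrum.basicOpen w := U.ι_image_top.trans hU
  have hloc : IsLocalization.Away w
      ((Spec.structureSheaf R).obj.obj (Opposite.op (U.ι ''ᵁ ⊤))) := by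
    rw [hV]
    exact StructureSheaf.IsLocalization.to_basicOpen R w
  -- the ring map `R → Γ(Spec R, ⊤) → Γ(U, ⊤)` is the localization map
  let φ : R →+* Γ((U : Scheme.{u}), ⊤) := U.ι.appTop.hom.comp (Scheme.ΓSpecIso (.of R)).inv.hom
  have hφ : ∀ s : R,
      φ s = algebraMap R ((Spec.structureSheaf R).obj.obj (Opposite.op (U.ι ''ᵁ ⊤))) s :=
    fun s => rfl
  have hu : IsUnit (φ w) := by
    rw [hφ]
    exact IsLocalization.Away.algebraMap_isUnit
      (S := (Spec.structureSheaf R).obj.obj (Opposite.op (U.ι ''ᵁ ⊤))) w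
  have hφg : φ g ∈ nonZeroDivisors Γ((U : Scheme.{u}), ⊤) := by
    rw [hφ]
    exact IsLocalization.nonZeroDivisors_le_comap (M := .powers w)
      (S := (Spec.structureSheaf R).obj.obj (Opposite.op (U.ι ''ᵁ ⊤))) hg0
  -- the Cartier chart: all of `U`, generator `g`
  intro p
  refine ⟨⟨⊤, isAffineOpen_top _⟩, trivial, φ g, hφg, ?_⟩
  rw [affineBlowup.idealSheaf, comap_ofIdealTop_of_isAffine, ideal_ofIdealTop_top, Ideal.map_map]
  change I.map φ = Ideal.span {φ g}
  apply le_antisymm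
  · rw [Ideal.map_le_iff_le_comap]
    intro i hi
    rw [Ideal.mem_comap, ← Ideal.mul_unit_mem_iff_mem _ hu, ← map_mul]
    have := Ideal.mem_map_of_mem φ (hI i hi)
    rwa [Ideal.map_span, Set.image_singleton] at this
  · rw [Ideal.span_singleton_le_iff_mem]
    exact Ideal.mem_map_of_mem φ hg

section Toric

variable (k : Type) [Field k]

/-- The Laurent polynomial ring `k[ℤ²]` (coordinate ring of the 2-torus). -/
local notation3 "Lk" => AddMonoidAlgebra k (ℤ × ℤ)

/-- The lattice points of the dual cone `σ∨ = {m₂ ≥ 0, a m₂ ≤ r m₁}` of `σ = cone((0,1),(r,-a))`. -/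
local notation3 "σS[" r ", " a "]" =>
  {m : ℤ × ℤ | 0 ≤ m.2 ∧ ((a : ℕ) : ℤ) * m.2 ≤ ((r : ℕ) : ℤ) * m.1}

/-- The toric surface algebra `k[σ∨ ∩ ℤ²] ⊆ k[ℤ²]`. -/
local notation3 "TA[" r ", " a "]" =>
  Algebra.adjoin k ((fun m : ℤ × ℤ => AddMonoidAlgebra.single m (1 : k)) '' σS[r, a])

/-- STUB (the blow-down is an isomorphism over `D(w)`, `w = χ^(a,r)` the second facet generator): for
`1 ≤ a ≤ r`, over the basic open `D(w) = Spec TA[r,a][1/w]` the centre `I = (xy, x, x)` becomes the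
principal ideal `(xy)` generated by a non-zero-divisor (`y⁻¹ = χ^(a, r−1)/w ∈ TA[r,a][1/w]`, so
`x = xy · y⁻¹ ∈ (xy)`), hence the pulled-back ideal sheaf is an effective Cartier divisor and the restricted
blow-up `π₀ ∣_ D(w)` — a blow-up of it, `(affineBlowup.isBlowup I).restrict` — is an isomorphism
(`IsBlowup.isIso`). [folklore; GortzWedhorn2020 Prop. 13.91] -/
theorem stub_toric_isIso_away_w (r a : ℕ) (ha : 1 ≤ a) (har : a ≤ r) (x xy w : ↥TA[r, a])
    (hx : (x : Lk) = AddMonoidAlgebra.single ((1 : ℤ), (0 : ℤ)) 1)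
    (hxy : (xy : Lk) = AddMonoidAlgebra.single ((1 : ℤ), (1 : ℤ)) 1)
    (hw : (w : Lk) = AddMonoidAlgebra.single ((a : ℤ), (r : ℤ)) 1) :
    IsIso (affineBlowup.π (Ideal.span {xy, x, x}) ∣_
      (PrimeSpectrum.basicOpen w : (Spec (CommRingCat.of ↥TA[r, a])).Opens)) := by
  -- the monomial `v = χ^(a, r-1)` of `TA[r,a]`, with `x * w = v * xy`
  have hvmem : (AddMonoidAlgebra.single ((a : ℤ), (r : ℤ) - 1) (1 : k) : Lk) ∈ TA[r, a] :=
    Algebra.subset_adjoin ⟨((a : ℤ), (r : ℤ) - 1),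
      ⟨show (0 : ℤ) ≤ (r : ℤ) - 1 by omega,
       show ((a : ℕ) : ℤ) * ((r : ℤ) - 1) ≤ ((r : ℕ) : ℤ) * (a : ℤ) by nlinarith⟩, rfl⟩
  have hxw : x * w = ⟨_, hvmem⟩ * xy := by
    apply Subtype.ext
    change (x : Lk) * (w : Lk) = AddMonoidAlgebra.single ((a : ℤ), (r : ℤ) - 1) (1 : k) * (xy : Lk)
    rw [hx, hw, hxy, AddMonoidAlgebra.single_mul_single, AddMonoidAlgebra.single_mul_single]
    congr 1
    simp only [Prod.mk_add_mk, Prod.mk.injEq]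
    constructor <;> omega
  -- `xy ≠ 0` in the domain `TA[r,a]`
  have hxy0 : xy ≠ 0 := by
    intro h0
    have h1 := congrArg Subtype.val h0
    rw [hxy, ZeroMemClass.coe_zero, AddMonoidAlgebra.single_eq_zero] at h1
    exact one_ne_zero h1
  refine isIso_affineBlowup_morphismRestrict_of_eq_basicOpen (Ideal.span {xy, x, x})
    (Ideal.subset_span (Set.mem_insert xy _)) (mem_nonZeroDivisors_of_ne_zero hxy0) ?_ _ rfl
  -- `I · w ⊆ (xy)`: check on the generators
  have hle : Ideal.span {xy, x, x} ≤ (Ideal.span {xy}).colon {w} := by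
    rw [Ideal.span_le]
    rintro s (rfl | rfl | rfl)
    · rw [SetLike.mem_coe, Submodule.mem_colon_singleton, smul_eq_mul]
      exact Ideal.mul_mem_right _ _ (Ideal.mem_span_singleton_self _)
    all_goals
      rw [SetLike.mem_coe, Submodule.mem_colon_singleton, smul_eq_mul, hxw]
      exact Ideal.mul_mem_left _ _ (Ideal.mem_span_singleton_self _)
  intro i hi
  have := hle hi
  rwa [Submodule.mem_colon_singleton, smul_eq_mul] at this

end Toric

end Summit.ResolutionOfSingularities.ResolutionOfSingularities.Theorems.FRationalResolution

end
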